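import Literature.Probability.RandomPlanarGeometry.SLESameSideSwallowing
import Literature.Probability.RandomPlanarGeometry.SLESwallowingNearZero
import Literature.Probability.RandomPlanarGeometry.CritPercSLELocalityMartingaleProofs
import Literature.Probability.RandomPlanarGeometry.LocalMartingaleProofs
import HarnessLib

/-!
# The event "an interval left of the origin is swallowed at once", and the Markov property

Trunk T-STOCH. Probabilistic plumbing for the proof of transience of the SLE trace for
`4 < κ < 8` (Rohde–Schramm (2005), Lemma 7.3, p. 910): the event that two negative real points
`a < b < 0` are swallowed by the chain of a driving path at the same time `≤ s₀`, as a measurable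
subset of the path space (`swallowAtOnceNegEvent`, read through the regularised path as in
`SLESwallowingNearZero`), its positive probability for SLE_κ, `4 < κ < 8`
(`exists_measure_swallowAtOnceNeg_pos`, from the same-side simultaneous swallowing
`measure_swallowingTime_eq_pos` — Rohde–Schramm's Lemma 6.6 in weak form — by the reflection
symmetry `W ↦ -W` and a.s. finiteness of swallowing times for `κ > 4`), and the Markov-property
product formula `P[A ∩ {W(q + ·) - W(q) ∈ E}] = P[A] · P[W ∈ E]` for past events `A ∈ 𝓕_q`
(`measure_inter_shift_mem_eq_mul`, Mathlib's weak Markov property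
`IsPreBrownianReal.indepFun_shift` and `identDistrib_sleDriving_shift`).

## References

* S. Rohde, O. Schramm, *Basic properties of SLE*, Ann. of Math. 161 (2005), Lemma 6.6,
  Lemma 7.3, Prop. 2.1 (Markov property).
* G. F. Lawler, *Conformally Invariant Processes in the Plane*, AMS (2005), §6.2, Prop. 6.8.
-/

noncomputable section

open Set Filter MeasureTheory ProbabilityTheory Complex
open _root_.Topology
open scoped NNReal ENNReal

namespace Literature.Probability.RandomPlanarGeometry

open Loewner

/-! ### Path-space events -/

/-- A rational time, as an element of `ℝ≥0` (negative rationals are sent to `0`). [folklore] -/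
abbrev ratTime (q : ℚ) : ℝ≥0 := Real.toNNReal q

/-- In `WithTop ℝ≥0`: if `S < T` then some rational time `q` has `S ≤ q` but not `T ≤ q`.
[folklore] -/
theorem exists_ratTime_of_lt {S T : WithTop ℝ≥0} (h : S < T) :
    ∃ q : ℚ, S ≤ ratTime q ∧ ¬ T ≤ ratTime q := by
  obtain ⟨s, rfl⟩ := WithTop.ne_top_iff_exists.1 (ne_top_of_lt h)
  induction T with
  | top =>
    obtain ⟨q, hq⟩ := exists_rat_gt (s : ℝ)
    refine ⟨q, WithTop.coe_le_coe.2 ?_, fun h ↦ WithTop.coe_ne_top (top_le_iff.1 h)⟩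
    rw [ratTime, ← NNReal.coe_le_coe, Real.coe_toNNReal _ (s.coe_nonneg.trans hq.le)]
    exact hq.le
  | coe t =>
    have hst : (s : ℝ) < t := by exact_mod_cast (WithTop.coe_lt_coe.1 h)
    obtain ⟨q, hsq, hqt⟩ := exists_rat_btwn hst
    have hq0 : (0 : ℝ) ≤ q := s.coe_nonneg.trans hsq.le
    refine ⟨q, WithTop.coe_le_coe.2 ?_, fun hle ↦ ?_⟩
    · rw [ratTime, ← NNReal.coe_le_coe, Real.coe_toNNReal _ hq0]
      exact hsq.le
    · have := WithTop.coe_le_coe.1 hle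
      rw [ratTime, ← NNReal.coe_le_coe, Real.coe_toNNReal _ hq0] at this
      linarith

/-- The path-space event **`{T_y = T_x ≤ s₀}`** for two positive points (read through the
regularised path `regPath`, cf. `swallowLeEvent`): `T_y ≤ s₀`, and `T_x ≤ q ↔ T_y ≤ q` for every
rational time `q`. [folklore] -/
def swallowAtOncePosEvent (x y : ℝ) (s₀ : ℝ≥0) : Set (ℝ≥0 → ℝ) :=
  swallowLeEvent y s₀ ∩ ⋂ q : ℚ, {w | w ∈ swallowLeEvent x (ratTime q) ↔ w ∈ swallowLeEvent y (ratTime q)}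

/-- `{w | w ∈ A ↔ w ∈ B}` is measurable. [folklore] -/
theorem measurableSet_setOf_iff {α : Type*} [MeasurableSpace α] {A B : Set α}
    (hA : MeasurableSet A) (hB : MeasurableSet B) : MeasurableSet {w | w ∈ A ↔ w ∈ B} := by
  have : {w | w ∈ A ↔ w ∈ B} = (A ∩ B) ∪ (Aᶜ ∩ Bᶜ) := by
    ext w
    simp only [mem_setOf_eq, mem_union, mem_inter_iff, mem_compl_iff]
    tauto
  rw [this]
  exact (hA.inter hB).union (hA.compl.inter hB.compl)

/-- `swallowAtOncePosEvent x y s₀` is measurable (`x, y > 0`). [folklore] -/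
theorem measurableSet_swallowAtOncePosEvent {x y : ℝ} (hx : 0 < x) (hy : 0 < y) (s₀ : ℝ≥0) :
    MeasurableSet (swallowAtOncePosEvent x y s₀) :=
  (measurableSet_swallowLeEvent hy s₀).inter (MeasurableSet.iInter fun q ↦
    measurableSet_setOf_iff (measurableSet_swallowLeEvent hx (ratTime q))
      (measurableSet_swallowLeEvent hy (ratTime q)))

/-- For a continuous path from `0`: membership in `swallowAtOncePosEvent x y s₀` is
`T_y = T_x ∧ T_y ≤ s₀`. [folklore] -/
theorem mem_swallowAtOncePosEvent_iff {w : ℝ≥0 → ℝ} (hw : Continuous w) (hw0 : w 0 = 0)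
    (x y : ℝ) (s₀ : ℝ≥0) :
    w ∈ swallowAtOncePosEvent x y s₀ ↔
      swallowingTime w y = swallowingTime w x ∧ swallowingTime w y ≤ s₀ := by
  simp only [swallowAtOncePosEvent, mem_inter_iff, mem_iInter, mem_setOf_eq,
    mem_swallowLeEvent_iff hw hw0]
  constructor
  · rintro ⟨hs, hiff⟩
    refine ⟨?_, hs⟩
    by_contra hne
    rcases lt_or_gt_of_ne hne with hlt | hlt
    · obtain ⟨q, h1, h2⟩ := exists_ratTime_of_lt hlt
      exact h2 ((hiff q).2 h1)
    · obtain ⟨q, h1, h2⟩ := exists_ratTime_of_lt hlt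
      exact h2 ((hiff q).1 h1)
  · rintro ⟨heq, hs⟩
    exact ⟨hs, fun q ↦ by rw [heq]⟩

/-- The path-space event **`{T_a = T_b ≤ s₀}`** for two negative points `a < b < 0`, through the
reflected path `-w` (`swallowingTime_neg_ofReal`). [folklore] -/
def swallowAtOnceNegEvent (a b : ℝ) (s₀ : ℝ≥0) : Set (ℝ≥0 → ℝ) :=
  {w | (fun u ↦ -w u) ∈ swallowAtOncePosEvent (-a) (-b) s₀}

/-- `swallowAtOnceNegEvent a b s₀` is measurable (`a, b < 0`). [folklore] -/
theorem measurableSet_swallowAtOnceNegEvent {a b : ℝ} (ha : a < 0) (hb : b < 0) (s₀ : ℝ≥0) :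
    MeasurableSet (swallowAtOnceNegEvent a b s₀) :=
  (measurableSet_swallowAtOncePosEvent (neg_pos.2 ha) (neg_pos.2 hb) s₀).preimage
    (measurable_pi_lambda _ fun u ↦ (measurable_pi_apply u).neg)

/-- For a continuous path from `0`: membership in `swallowAtOnceNegEvent a b s₀` is
`T_a = T_b ∧ T_b ≤ s₀`. [folklore] -/
theorem mem_swallowAtOnceNegEvent_iff {w : ℝ≥0 → ℝ} (hw : Continuous w) (hw0 : w 0 = 0)
    (a b : ℝ) (s₀ : ℝ≥0) :
    w ∈ swallowAtOnceNegEvent a b s₀ ↔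
      swallowingTime w a = swallowingTime w b ∧ swallowingTime w b ≤ s₀ := by
  rw [swallowAtOnceNegEvent, mem_setOf_eq,
    mem_swallowAtOncePosEvent_iff (w := fun u ↦ -w u) hw.neg (by simp [hw0]) (-a) (-b) s₀,
    swallowingTime_neg_ofReal, swallowingTime_neg_ofReal]
  exact ⟨fun h ↦ ⟨h.1.symm, h.2⟩, fun h ↦ ⟨h.1.symm, h.2⟩⟩

/-! ### Positive probability for SLE_κ, `4 < κ < 8` -/

section SLE

variable {κ : ℝ≥0}

/-- **For `0 < y < x` and `4 < κ < 8`: `P[T_y = T_x ≤ s₀] > 0` for some `s₀`** (same-side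
simultaneous swallowing `measure_swallowingTime_eq_pos`, and `T_y < ∞` a.s. for `κ > 4`).
[cite: RohdeSchramm2005, Lemma 6.6] -/
theorem exists_measure_swallowAtOncePos_pos (hκ4 : 4 < κ) (hκ8 : κ < 8) {x y : ℝ} (hy : 0 < y)
    (hyx : y < x) :
    ∃ s₀ : ℝ≥0, 0 < Process.preWienerMeasure
      {ω | (fun u ↦ sleDriving κ ω u) ∈ swallowAtOncePosEvent x y s₀} := by
  have hpos := measure_swallowingTime_eq_pos hκ4 hκ8 hy hyx
  have hfin := sle_swallowingTime_lt_top_of_onePointMartingales sle_martingale_onePointPow_holds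
    sle_martingale_onePointSq_holds hκ4 hy
  by_contra hall
  push Not at hall
  have hzero : ∀ n : ℕ, Process.preWienerMeasure
      {ω | (fun u ↦ sleDriving κ ω u) ∈ swallowAtOncePosEvent x y (n : ℝ≥0)} = 0 :=
    fun n ↦ le_antisymm (hall n) bot_le
  have hU : Process.preWienerMeasure
      (⋃ n : ℕ, {ω | (fun u ↦ sleDriving κ ω u) ∈ swallowAtOncePosEvent x y (n : ℝ≥0)}) = 0 :=
    measure_iUnion_null hzero
  refine hpos.ne' (measure_mono_null_ae ?_ hU)
  filter_upwards [hfin] with ω hω heq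
  obtain ⟨T, hT⟩ := WithTop.ne_top_iff_exists.1 hω.ne
  obtain ⟨n, hn⟩ := exists_nat_ge T
  refine mem_iUnion.2 ⟨n, ?_⟩
  rw [mem_setOf_eq, mem_swallowAtOncePosEvent_iff (continuous_sleDriving κ ω) (sleDriving_zero κ ω)]
  refine ⟨heq, ?_⟩
  rw [← hT]
  exact_mod_cast hn

/-- **For `a < b < 0` and `4 < κ < 8`: `P[T_a = T_b ≤ s₀] > 0` for some `s₀`** — "there is
positive probability that the interval `[a, b]` is swallowed all at once" in finite time
(Rohde–Schramm (2005), Lemma 6.6 as used in Lemma 7.3), by the reflection symmetry `W ↦ -W`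
(`identDistrib_sleDriving_neg`) from the positive side. [cite: RohdeSchramm2005, Lemma 6.6] -/
theorem exists_measure_swallowAtOnceNeg_pos (hκ4 : 4 < κ) (hκ8 : κ < 8) {a b : ℝ} (hab : a < b)
    (hb : b < 0) :
    ∃ s₀ : ℝ≥0, 0 < Process.preWienerMeasure
      {ω | (fun u ↦ sleDriving κ ω u) ∈ swallowAtOnceNegEvent a b s₀} := by
  obtain ⟨s₀, hs₀⟩ := exists_measure_swallowAtOncePos_pos hκ4 hκ8 (neg_pos.2 hb) (by linarith : -b < -a)
  refine ⟨s₀, ?_⟩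
  have hmeas := measurableSet_swallowAtOncePosEvent (x := -a) (y := -b) (by linarith) (by linarith) s₀
  have h := (identDistrib_sleDriving_neg κ).measure_mem_eq hmeas
  have hset : {ω : ℝ≥0 → ℝ | (fun u ↦ sleDriving κ ω u) ∈ swallowAtOnceNegEvent a b s₀} =
      (fun ω t ↦ -sleDriving κ ω t) ⁻¹' swallowAtOncePosEvent (-a) (-b) s₀ := by
    ext ω; rfl
  rw [hset, ← h]
  exact hs₀

/-! ### The Markov property for the shifted driving function -/

/-- **Markov product formula.** For a past event `A ∈ 𝓕_q` (natural filtration of the Brownian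
motion) and a measurable set `E` of paths,
`P[A ∩ {W(q + ·) - W(q) ∈ E}] = P[A] · P[W ∈ E]` (`W = √κ B`): independence of the increments
after `q` from `𝓕_q` (Mathlib `IsPreBrownianReal.indepFun_shift`, `brownianFiltration_eq_comap`)
and stationarity (`identDistrib_sleDriving_shift`). Rohde–Schramm (2005), Prop. 2.1; Lawler
(2005), §6.2. [cite: RohdeSchramm2005, Prop. 2.1] -/
theorem measure_inter_shift_mem_eq_mul (κ : ℝ≥0) (q : ℝ≥0) {A : Set (ℝ≥0 → ℝ)}
    (hA : MeasurableSet[brownianFiltration q] A) {E : Set (ℝ≥0 → ℝ)} (hE : MeasurableSet E) :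
    Process.preWienerMeasure (A ∩ {ω | (fun u ↦ sleDriving κ ω (q + u) - sleDriving κ ω q) ∈ E}) =
      Process.preWienerMeasure A *
        Process.preWienerMeasure {ω | (fun u ↦ sleDriving κ ω u) ∈ E} := by
  -- the past event as a preimage under the restricted path
  rw [brownianFiltration_eq_comap] at hA
  obtain ⟨B, hB, rfl⟩ := hA
  -- the future event as a preimage under the Brownian increments
  have hsc : Measurable fun (p : ℝ≥0 → ℝ) (u : ℝ≥0) ↦ Real.sqrt κ * p u :=
    measurable_pi_lambda _ fun u ↦ (measurable_pi_apply u).const_mul _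
  have hfut : {ω : ℝ≥0 → ℝ | (fun u ↦ sleDriving κ ω (q + u) - sleDriving κ ω q) ∈ E} =
      (fun ω u ↦ Process.brownian (q + u) ω - Process.brownian q ω) ⁻¹'
        ((fun p u ↦ Real.sqrt κ * p u) ⁻¹' E) := by
    ext ω
    simp only [mem_setOf_eq, mem_preimage]
    have hfun : (fun u ↦ sleDriving κ ω (q + u) - sleDriving κ ω q) =
        fun u ↦ Real.sqrt κ * (Process.brownian (q + u) ω - Process.brownian q ω) :=
      funext fun u ↦ by simp only [sleDriving, mul_sub]
    rw [hfun]
  have hind := (isPreBrownianReal_brownian.indepFun_shift q).measure_inter_preimage_eq_mul _ _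
    (hsc hE) hB
  rw [inter_comm, hfut, hind, mul_comm]
  congr 1
  -- stationarity of the increments
  have hlaw := (identDistrib_sleDriving_shift κ q).measure_mem_eq hE
  rw [← hfut]
  exact hlaw.symm

/-- **With positive probability the past event happens and then `[a, b]` is swallowed at once.**
For `4 < κ < 8`, `a < b < 0` and a past event `A ∈ 𝓕_q` of positive probability, for some `s₀`
the event `A ∩ {T_a[W^{(q)}] = T_b[W^{(q)}] ≤ s₀}` has positive probability, where
`W^{(q)} = W(q + ·) - W(q)`. [cite: RohdeSchramm2005, Lemma 7.3] -/
theorem exists_measure_inter_shift_swallowAtOnceNeg_pos (hκ4 : 4 < κ) (hκ8 : κ < 8) (q : ℝ≥0)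
    {A : Set (ℝ≥0 → ℝ)} (hA : MeasurableSet[brownianFiltration q] A)
    (hApos : Process.preWienerMeasure A ≠ 0) {a b : ℝ} (hab : a < b) (hb : b < 0) :
    ∃ s₀ : ℝ≥0, Process.preWienerMeasure (A ∩ {ω |
      (fun u ↦ sleDriving κ ω (q + u) - sleDriving κ ω q) ∈ swallowAtOnceNegEvent a b s₀}) ≠ 0 := by
  obtain ⟨s₀, hs₀⟩ := exists_measure_swallowAtOnceNeg_pos hκ4 hκ8 hab hb
  refine ⟨s₀, ?_⟩
  rw [measure_inter_shift_mem_eq_mul κ q hA (measurableSet_swallowAtOnceNegEvent (hab.trans hb) hb s₀)]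
  exact mul_ne_zero hApos hs₀.ne'

end SLE

end Literature.Probability.RandomPlanarGeometry
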